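import Mathlib
import HarnessLib
import Literature.Computability.Complexity.ConstantDepth
import Literature.Computability.Complexity.FourierTails
import Literature.Computability.Complexity.RandomKSatLowDegreeHardness

/-!
# PneNP / OverlapGapAlgebra — `SearchHardWindow` (crux stmt-PneNP-2460), Line A rung assembly

Registered stub `stub_rungAssembly` of the skeleton `Cruxes/SearchHardWindow/Lines/Sketch.lean`
(Line A = card `approx-degree-ladder`): the first unconditional-modulo-citation RUNG of the ladder,
assembled from three inputs —

* the named fact `Literature.Computability.Complexity.HuangSellke2025KSat` (Huang–Sellke 2025,
  arXiv:2501.06427 Cor. 3.21: strong low-degree hardness of random `k`-SAT at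
  `α_k = 5 · 2^k log k / k`, deterministic saturated special case),
* the truncation surrogate (hypothesis `hT` = stub `stub_truncationSurrogate`: Walsh truncation
  below level `D` of `n'` Boolean functions on `{0,1}^N` gives saturated degree-`< D` sign
  surrogates of energy `≤ 9 n' 2^N`, wrong on `≤ 9 n' τ 2^N` inputs when all tails `W^{≥D} ≤ τ`),
* Tal's Fourier tails of `AC⁰` in asymptotic form (hypothesis `hA` = stub `stub_acTailBound`,
  landed as `Theorems/OverlapGapAlgebraSearchHardWindowACTailBound.lean`),

— giving, through the general CLASS RUNG `shw_classRung` (any classes `𝒢 n N` of Boolean functions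
on `N` bits whose Fourier tails above some level `D n = o(n)` are eventually `≤ n⁻³`): **eventually
in `n`, whenever `n = 2^j`, every family of depth-`d`, size-`n^c` `acBasis` circuits (one circuit
per output variable, reading the `m·k·(j+1)` bits of a literal array under `litArrayOfBits`,
`m = ⌊α_k n⌋`) outputs a satisfying assignment of `F_k(2^j, m)` for at most an `ε`-fraction of the
inputs** (`k ≥ k₀` of the fact; any `d, c, ε > 0`). The discharge of `hT`, `hA` by the landed stubs
and the decision-tree rung are in `OverlapGapAlgebraSearchHardWindowRungs.lean`.

Proof. For each `j` pick, if one exists, an admissible family `C_j` succeeding on `> ε · 2^N`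
inputs (`N = m k (j+1)`). Truncate each output below the level `D(2^j)` of `hA` (via `hT`, with the
tail level `τ_j` = `n⁻³` as soon as Tal's bound holds, else the trivial sum of tails) to get Walsh
sums `P_j`; read through the inverse encoding `bitsOfLitArray` they become functions `G_j` on
literal arrays of coordinate degree `< D(2^j)` in the `m·k` literal slots (a Walsh character of the
bits in `S` depends only on the slots of `S`) and of energy `≤ 9 · 2^j · #Φ` (the encoding is a
bijection, `litArrayEquiv`). Transported to all `(n, m)` (zero off `n = 2^j, m = ⌊α_k n⌋`;
transport along `Nat.log 2 (2^j) = j`) this is an admissible sequence for the named fact, which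
bounds the saturated sign-successes of `G_j` by `ε/2 · #Φ` eventually. On the other hand the inputs
solved by `C_j` are either good (surrogate saturated with the circuit's signs — these inject, via
`litArrayOfBits`, into the event just bounded) or among the `≤ 9 · 2^j · 2^{-3j} · 2^N ≤ ε/2 · 2^N`
bad inputs. So `C_j` succeeds on `≤ ε 2^N` inputs: no bad family exists for large `n = 2^j`.

Transport of literal arrays along parameter equalities is written out as the explicit map
`Φ ↦ fun a b => ((Φ (a.cast _) b).1.cast _, (Φ (a.cast _) b).2)` (lemmas `shwRung_*_cast`); the
bit-encoding API (`bitsOfLitArray`, `litArrayEquiv`, …) is the tree's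
(`RandomKSatLowDegreeHardness.lean`). No definitions are introduced.

Prover prover-line-stmt-PneNP-2460-0 (line lead), 2026-08-16. -/

-- `Summit.PneNP.PneNP.…` is the tree's mandated namespace (summit = sub-problem name).
set_option linter.dupNamespace false

noncomputable section

namespace Summit.PneNP.PneNP.Theorems

open Finset Filter Asymptotics
open Literature.Computability.Complexity
open Literature.Computability.Complexity.LowDegree
open Literature.Probability.RandomGraphs.LowDegree (sgn walsh)
open scoped Classical

/-! ## Transport of literal arrays along parameter equalities -/

section Cast

/-- Reindexing a double sum along the transport. [folklore] -/
theorem shwRung_sum_cast {m m' n n' k : ℕ} (hm : m = m') (hn : n = n')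
    (H : (Fin m' → Fin k → Fin n' × Bool) → Fin n' → ℝ) :
    ∑ Φ : Fin m → Fin k → Fin n × Bool, ∑ v : Fin n,
        H (fun a b => (((Φ (a.cast hm.symm) b).1).cast hn, (Φ (a.cast hm.symm) b).2)) (v.cast hn) =
      ∑ Ψ : Fin m' → Fin k → Fin n' × Bool, ∑ v : Fin n', H Ψ v := by
  subst hm; subst hn; simp

/-- The transport preserves the number of literal arrays. [folklore] -/
theorem shwRung_card_cast {m m' n n' : ℕ} (k : ℕ) (hm : m = m') (hn : n = n') :
    Fintype.card (Fin m → Fin k → Fin n × Bool) =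
      Fintype.card (Fin m' → Fin k → Fin n' × Bool) := by
  subst hm; subst hn; rfl

/-- Coordinate degree is invariant under the transport. [folklore] -/
theorem shwRung_isCoordDegreeLE_cast {m m' n n' k D : ℕ} (hm : m = m') (hn : n = n')
    (H : (Fin m' → Fin k → Fin n' × Bool) → ℝ)
    (hH : IsCoordDegreeLE D (fun y : Fin m' × Fin k → Fin n' × Bool => H (Function.curry y))) :
    IsCoordDegreeLE D
      (fun y : Fin m × Fin k → Fin n × Bool => H (fun a b =>
        (((Function.curry y (a.cast hm.symm) b).1).cast hn,
          (Function.curry y (a.cast hm.symm) b).2))) := by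
  subst hm; subst hn
  have e : (fun y : Fin m × Fin k → Fin n × Bool => H (fun a b =>
      (((Function.curry y (a.cast rfl) b).1).cast rfl, (Function.curry y (a.cast rfl) b).2))) =
      fun y => H (Function.curry y) := by
    funext y; congr 1
  rw [e]; exact hH

/-- A `j`-indexed family evaluated through the transport along `j'' = j`. [folklore] -/
theorem shwRung_cast_transport {k : ℕ} (M : ℕ → ℕ)
    (G : (j : ℕ) → (Fin (M j) → Fin k → Fin (2 ^ j) × Bool) → Fin (2 ^ j) → ℝ)
    {j j'' : ℕ} (e : j'' = j) (hm : M j = M j'') (hn : 2 ^ j = 2 ^ j'')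
    (Φ : Fin (M j) → Fin k → Fin (2 ^ j) × Bool) (v : Fin (2 ^ j)) :
    G j'' (fun a b => (((Φ (a.cast hm.symm) b).1).cast hn, (Φ (a.cast hm.symm) b).2))
      (Fin.cast hn v) = G j Φ v := by
  subst e; simp

end Cast

/-! ## Degree of Walsh characters read through the bit encoding -/
/-- A Walsh character of the bits in `S`, read through the inverse encoding, depends only on the
literal slots of `S`. [folklore] -/
theorem shwRung_dependsOn_walsh_bits (m k j : ℕ) (S : Finset (Fin (m * k * (j + 1)))) :
    DependsOn (fun y : Fin m × Fin k → Fin (2 ^ j) × Bool =>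
        walsh S (bitsOfLitArray m k j (Function.curry y)))
      (↑(S.image (litArrayBitSlot m k j)) : Set (Fin m × Fin k)) := by
  intro y y' h
  unfold walsh
  refine Finset.prod_congr rfl fun i hi => ?_
  congr 1
  apply bitsOfLitArray_eq_of_slot_eq
  have := h (litArrayBitSlot m k j i) (by exact_mod_cast Finset.mem_image_of_mem _ hi)
  simpa [Function.curry] using this

/-- A Walsh sum with no coefficients at level `≥ D`, read through the inverse encoding, has
coordinate degree `≤ D` in the literal slots. [folklore] -/
theorem shwRung_isCoordDegreeLE_walshSum (m k j D : ℕ) (c : Finset (Fin (m * k * (j + 1))) → ℝ)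
    (hc : ∀ S, D ≤ S.card → c S = 0) :
    IsCoordDegreeLE D (fun y : Fin m × Fin k → Fin (2 ^ j) × Bool =>
      ∑ S, c S * walsh S (bitsOfLitArray m k j (Function.curry y))) := by
  refine IsCoordDegreeLE.sum univ fun S _ => ?_
  by_cases hS : D ≤ S.card
  · have : (fun y : Fin m × Fin k → Fin (2 ^ j) × Bool =>
        c S * walsh S (bitsOfLitArray m k j (Function.curry y))) = fun _ => 0 := by
      funext y; rw [hc S hS, zero_mul]
    rw [this]; exact IsCoordDegreeLE.zero D
  · push Not at hS
    exact (IsCoordDegreeLE.of_dependsOn (S.image (litArrayBitSlot m k j))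
      (card_image_le.trans hS.le) (shwRung_dependsOn_walsh_bits m k j S)).smul (c S)

/-- Splitting a count along a second predicate: `#{p} ≤ #{p ∧ q} + #{¬ q}`. [folklore] -/
theorem shwRung_card_filter_le_and_add_not {α : Type*} [Fintype α] (p q : α → Prop)
    [DecidablePred p] [DecidablePred q] :
    (univ.filter p).card ≤
      (univ.filter fun x => p x ∧ q x).card + (univ.filter fun x => ¬ q x).card := by
  calc (univ.filter p).card
      = ((univ.filter p).filter q).card + ((univ.filter p).filter fun x => ¬ q x).card :=
        (Finset.card_filter_add_card_filter_not _).symm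
    _ ≤ (univ.filter fun x => p x ∧ q x).card + (univ.filter fun x => ¬ q x).card := by
        refine Nat.add_le_add (le_of_eq ?_) (card_le_card fun x hx => ?_)
        · rw [filter_filter]
        · simp only [mem_filter, mem_univ, true_and] at hx ⊢
          exact hx.2
/-! ## The class rung (general form) -/

/-- **Class rung (general form).** Let `𝒢 n N` be, for each `n`, a class of Boolean functions on
`N` input bits whose Fourier tails above a level `D n = o(n)` (`D n ≥ 1`) are eventually `≤ n⁻³`.
Assuming the named fact `HuangSellke2025KSat` and the truncation surrogate `hT`: for `k ≥ k₀` (of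
the fact) and `ε > 0`, eventually in `n`, whenever `n = 2^j` and `m = ⌊5 · 2^k log k / k · n⌋`,
every family `g : Fin (2^j) → 𝒢 n (m k (j+1))` (one Boolean function per output variable, reading
the instance bits) outputs a satisfying assignment of the decoded literal array for at most
`ε · 2^{m k (j+1)}` inputs. See the module docstring for the proof. [folklore] -/
theorem shw_classRung (hLDH : HuangSellke2025KSat)
    (hT : ∀ {N n' : ℕ} (D : ℕ), 1 ≤ D → ∀ (g : Fin n' → (Fin N → Bool) → Bool) (τ : ℝ),
      (∀ v, tailWeight (fun x => sgn (g v x)) D ≤ τ) →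
      ∃ c : Fin n' → Finset (Fin N) → ℝ,
        (∀ v S, D ≤ S.card → c v S = 0) ∧
        (∑ x : Fin N → Bool, ∑ v, (∑ S, c v S * walsh S x) ^ 2 ≤ 9 * n' * 2 ^ N) ∧
        ((univ.filter fun x : Fin N → Bool => ¬ ∀ v, (1 ≤ |∑ S, c v S * walsh S x| ∧
            decide (0 ≤ ∑ S, c v S * walsh S x) = g v x)).card : ℝ) ≤ 9 * n' * τ * 2 ^ N) :
    ∃ k₀ : ℕ, ∀ k : ℕ, k₀ ≤ k → ∀ (𝒢 : (n N : ℕ) → ((Fin N → Bool) → Bool) → Prop) (D : ℕ → ℕ),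
      (fun n : ℕ => (D n : ℝ)) =o[atTop] (fun n : ℕ => (n : ℝ)) → (∀ n, 1 ≤ D n) →
      (∀ᶠ n : ℕ in atTop, ∀ (N : ℕ) (g : (Fin N → Bool) → Bool), 𝒢 n N g →
        tailWeight (fun x => sgn (g x)) (D n) ≤ 1 / (n : ℝ) ^ 3) →
      ∀ ε : ℝ, 0 < ε →
      ∀ᶠ n : ℕ in atTop, ∀ j m : ℕ, n = 2 ^ j → m = ⌊5 * 2 ^ k * Real.log k / k * n⌋₊ →
        ∀ g : Fin (2 ^ j) → (Fin (m * k * (j + 1)) → Bool) → Bool,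
          (∀ v, 𝒢 n (m * k * (j + 1)) (g v)) →
          ((univ.filter fun x : Fin (m * k * (j + 1)) → Bool =>
              ∀ i : Fin m, ∃ j' : Fin k, g (litArrayOfBits m k j x i j').1 x =
                (litArrayOfBits m k j x i j').2).card : ℝ)
            ≤ ε * 2 ^ (m * k * (j + 1)) := by
  obtain ⟨k₀, hLDH⟩ := hLDH
  refine ⟨k₀, fun k hk 𝒢 D hDo hD1 hTail ε hε => ?_⟩
  -- numbers of clauses and of instance bits at level `j` (`n = 2^j`, `m = M j = ⌊α_k 2^j⌋`)
  let M : ℕ → ℕ := fun j => ⌊5 * 2 ^ k * Real.log k / k * ((2 ^ j : ℕ) : ℝ)⌋₊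
  let N : ℕ → ℕ := fun j => M j * k * (j + 1)
  let OK : (j : ℕ) → (Fin (2 ^ j) → (Fin (N j) → Bool) → Bool) → Prop := fun j g =>
    ∀ v, 𝒢 (2 ^ j) (N j) (g v)
  let cnt : (j : ℕ) → (Fin (2 ^ j) → (Fin (N j) → Bool) → Bool) → ℕ := fun j g =>
    (univ.filter fun x : Fin (N j) → Bool => ∀ i, ∃ j',
      g (litArrayOfBits (M j) k j x i j').1 x =
        (litArrayOfBits (M j) k j x i j').2).card
  let bad : ℕ → Prop := fun j => ∃ g, OK j g ∧ ε * 2 ^ (N j) < (cnt j g : ℝ)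
  -- a bad family wherever one exists
  obtain ⟨gb, hgb⟩ : ∃ gb : (j : ℕ) → Fin (2 ^ j) → (Fin (N j) → Bool) → Bool,
      ∀ j, bad j → OK j (gb j) ∧ ε * 2 ^ (N j) < (cnt j (gb j) : ℝ) := by
    refine ⟨fun j => if h : bad j then h.choose else fun _ _ => false, fun j hj => ?_⟩
    simp only [dif_pos hj]
    exact hj.choose_spec
  -- tail levels (equal to `n⁻³` as soon as the tail bound is available)
  let τ : ℕ → ℝ := fun j =>
    if ∀ v, tailWeight (fun x => sgn (gb j v x)) (D (2 ^ j)) ≤ 1 / ((2 ^ j : ℕ) : ℝ) ^ 3 then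
      1 / ((2 ^ j : ℕ) : ℝ) ^ 3
    else ∑ v, tailWeight (fun x => sgn (gb j v x)) (D (2 ^ j))
  have hτ : ∀ j v, tailWeight (fun x => sgn (gb j v x)) (D (2 ^ j)) ≤ τ j := by
    intro j v
    simp only [τ]
    split_ifs with h
    · exact h v
    · exact Finset.single_le_sum
        (f := fun w => tailWeight (fun x => sgn (gb j w x)) (D (2 ^ j)))
        (fun w _ => tailWeight_nonneg _ _) (mem_univ v)
  -- surrogate coefficients from the truncation stub
  choose coef hcoef0 hcoefE hcoefB using
    fun j => hT (D (2 ^ j)) (hD1 _) (fun v x => gb j v x) (τ j) (hτ j)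
  -- the low-degree functions: on the cube, on literal arrays at level `j`, and for all `(n, m)`
  let P : (j : ℕ) → (Fin (N j) → Bool) → Fin (2 ^ j) → ℝ := fun j x v => ∑ S, coef j v S * walsh S x
  let G : (j : ℕ) → (Fin (M j) → Fin k → Fin (2 ^ j) × Bool) → Fin (2 ^ j) → ℝ :=
    fun j Ψ v => P j (bitsOfLitArray (M j) k j Ψ) v
  let F : (n m : ℕ) → (Fin m → Fin k → Fin n × Bool) → Fin n → ℝ := fun n m Φ v =>
    if h : 2 ^ Nat.log 2 n = n ∧ m = M (Nat.log 2 n) then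
      G (Nat.log 2 n) (fun a b => (((Φ (a.cast h.2.symm) b).1).cast h.1.symm,
        (Φ (a.cast h.2.symm) b).2)) (v.cast h.1.symm)
    else 0
  -- (i) coordinate degree
  have hGdeg : ∀ (j : ℕ) (v : Fin (2 ^ j)), IsCoordDegreeLE (D (2 ^ j))
      (fun y : Fin (M j) × Fin k → Fin (2 ^ j) × Bool => G j (Function.curry y) v) :=
    fun j v =>
      shwRung_isCoordDegreeLE_walshSum (M j) k j (D (2 ^ j)) (coef j v) (hcoef0 j v)
  have hdeg : ∀ (n m : ℕ) (v : Fin n), IsCoordDegreeLE (D n)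
      (fun y : Fin m × Fin k → Fin n × Bool => F n m (Function.curry y) v) := by
    intro n m v
    by_cases h : 2 ^ Nat.log 2 n = n ∧ m = M (Nat.log 2 n)
    · have hfun : (fun y : Fin m × Fin k → Fin n × Bool => F n m (Function.curry y) v) =
          fun y =>
            G (Nat.log 2 n) (fun a b => (((Function.curry y (a.cast h.2.symm) b).1).cast h.1.symm,
              (Function.curry y (a.cast h.2.symm) b).2)) (v.cast h.1.symm) := by
        funext y; simp only [F, dif_pos h]
      rw [hfun]
      have hD : D n = D (2 ^ Nat.log 2 n) := by rw [h.1]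
      rw [hD]
      exact shwRung_isCoordDegreeLE_cast h.2 h.1.symm
        (fun Ψ => G (Nat.log 2 n) Ψ (v.cast h.1.symm)) (hGdeg (Nat.log 2 n) (v.cast h.1.symm))
    · have hfun : (fun y : Fin m × Fin k → Fin n × Bool => F n m (Function.curry y) v) =
          fun _ => 0 := by
        funext y; simp only [F, dif_neg h]
      rw [hfun]; exact IsCoordDegreeLE.zero _
  -- (ii) energy
  have hener : ∀ n m : ℕ, m = ⌊5 * 2 ^ k * Real.log k / k * n⌋₊ →
      ∑ Φ : Fin m → Fin k → Fin n × Bool, ∑ v : Fin n, F n m Φ v ^ 2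
        ≤ 9 * n * Fintype.card (Fin m → Fin k → Fin n × Bool) := by
    intro n m _
    by_cases h : 2 ^ Nat.log 2 n = n ∧ m = M (Nat.log 2 n)
    · have hsum : ∑ Φ : Fin m → Fin k → Fin n × Bool, ∑ v : Fin n, F n m Φ v ^ 2 =
          ∑ Φ : Fin m → Fin k → Fin n × Bool, ∑ v : Fin n,
            (fun Ψ w => G (Nat.log 2 n) Ψ w ^ 2) (fun a b =>
              (((Φ (a.cast h.2.symm) b).1).cast h.1.symm, (Φ (a.cast h.2.symm) b).2))
              (v.cast h.1.symm) := by
        simp only [F, dif_pos h]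
      rw [hsum, shwRung_sum_cast h.2 h.1.symm (fun Ψ w => G (Nat.log 2 n) Ψ w ^ 2),
        shwRung_card_cast k h.2 h.1.symm, card_litArray_two_pow]
      have hG : ∑ Ψ : Fin (M (Nat.log 2 n)) → Fin k → Fin (2 ^ Nat.log 2 n) × Bool, ∑ w,
          G (Nat.log 2 n) Ψ w ^ 2 =
            ∑ x : Fin (N (Nat.log 2 n)) → Bool, ∑ w, P (Nat.log 2 n) x w ^ 2 := by
        refine Fintype.sum_equiv
          (litArrayEquiv (M (Nat.log 2 n)) k (Nat.log 2 n)).symm _ _ fun Ψ => ?_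
        rfl
      rw [hG]
      have hE := hcoefE (Nat.log 2 n)
      have hn : (n : ℝ) = ((2 ^ Nat.log 2 n : ℕ) : ℝ) := by rw [h.1]
      rw [hn]
      push_cast at hE ⊢
      exact hE
    · have h0 : ∑ Φ : Fin m → Fin k → Fin n × Bool, ∑ v : Fin n, F n m Φ v ^ 2 = 0 := by
        simp only [F, dif_neg h]; simp
      rw [h0]; positivity
  -- (iii) the named fact, the tail bound and the small error term, eventually
  have hev := hLDH k hk 9 (by norm_num) D hDo F hdeg hener (ε / 2) (half_pos hε)
  have hsmall : ∀ᶠ n : ℕ in atTop, (9 : ℝ) * n * (1 / (n : ℝ) ^ 3) ≤ ε / 2 := by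
    filter_upwards [eventually_ge_atTop (⌈18 / ε⌉₊ + 1)] with n hn
    have hn1 : (1 : ℝ) ≤ n := by exact_mod_cast le_trans (Nat.le_add_left 1 _) hn
    have hnε : 18 / ε ≤ n := (Nat.le_ceil _).trans (by exact_mod_cast le_trans (Nat.le_succ _) hn)
    have hnpos : (0 : ℝ) < n := by linarith
    have h18 : 18 ≤ ε * n := by rwa [div_le_iff₀ hε, mul_comm] at hnε
    have h18' : 18 ≤ ε * n ^ 2 := h18.trans (by nlinarith)
    rw [mul_one_div, div_le_iff₀ (by positivity)]
    nlinarith [h18', hnpos]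
  filter_upwards [hev, hTail, hsmall] with n hn1 hn2 hn3
  intro j m hnj hm g hOK
  subst hnj
  subst hm
  -- from now on `n = 2^j`, `m = M j`
  by_contra hlt
  rw [not_le] at hlt
  have hbad : bad j := by simp only [bad]; exact ⟨g, hOK, hlt⟩
  obtain ⟨hOKb, hcntb⟩ := hgb j hbad
  -- the tail bound is available for the chosen bad family, so `τ j = n⁻³`
  have hτj : τ j = 1 / ((2 ^ j : ℕ) : ℝ) ^ 3 := by
    simp only [τ]
    rw [if_pos]
    intro v
    exact hn2 _ _ (hOKb v)
  -- good inputs: the surrogate is saturated and has the family's signs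
  let good : (Fin (N j) → Bool) → Prop := fun x =>
    ∀ v, 1 ≤ |P j x v| ∧ decide (0 ≤ P j x v) = gb j v x
  have hbadset : ((univ.filter fun x : Fin (N j) → Bool => ¬ good x).card : ℝ) ≤
      ε / 2 * 2 ^ (N j) := by
    refine (hcoefB j).trans ?_
    rw [hτj]
    exact mul_le_mul_of_nonneg_right hn3 (by positivity : (0 : ℝ) ≤ 2 ^ (N j))
  -- good solved inputs inject into the event bounded by the named fact
  have hgoodset : ((univ.filter fun x : Fin (N j) → Bool => (∀ i, ∃ j',
      gb j (litArrayOfBits (M j) k j x i j').1 x =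
        (litArrayOfBits (M j) k j x i j').2) ∧ good x).card : ℝ) ≤ ε / 2 * 2 ^ (N j) := by
    have key : ∀ (Φ : Fin (M j) → Fin k → Fin (2 ^ j) × Bool) (v : Fin (2 ^ j)),
        F (2 ^ j) (M j) Φ v = G j Φ v := by
      intro Φ v
      have h1 : 2 ^ Nat.log 2 (2 ^ j) = 2 ^ j := by rw [Nat.log_pow Nat.one_lt_ofNat]
      have h2 : M j = M (Nat.log 2 (2 ^ j)) := by
        rw [Nat.log_pow Nat.one_lt_ofNat]
      have h12 : 2 ^ Nat.log 2 (2 ^ j) = 2 ^ j ∧ M j = M (Nat.log 2 (2 ^ j)) :=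
        ⟨h1, h2⟩
      have hF : F (2 ^ j) (M j) Φ v =
          G (Nat.log 2 (2 ^ j)) (fun a b => (((Φ (a.cast h2.symm) b).1).cast h1.symm,
            (Φ (a.cast h2.symm) b).2)) (v.cast h1.symm) := by
        simp only [F, dif_pos h12]
      rw [hF]
      exact shwRung_cast_transport M G (Nat.log_pow Nat.one_lt_ofNat j) h2 h1.symm Φ v
    have hfact := hn1 (M j) rfl
    rw [card_litArray_two_pow] at hfact
    push_cast at hfact
    refine le_trans ?_ hfact
    refine Nat.cast_le.2 (Finset.card_le_card_of_injOn (litArrayOfBits (M j) k j)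
      (fun x hx => ?_) (fun x _ y _ hxy => litArrayOfBits_injective hxy))
    simp only [coe_filter, mem_univ, true_and, Set.mem_setOf_eq] at hx ⊢
    obtain ⟨hsol, hgood⟩ := hx
    refine ⟨fun v => ?_, fun i => ?_⟩
    · rw [key]
      simpa [G, bitsOfLitArray_litArrayOfBits] using (hgood v).1
    · obtain ⟨j', hj'⟩ := hsol i
      refine ⟨j', ?_⟩
      rw [key, ← hj']
      simpa [G, bitsOfLitArray_litArrayOfBits] using (hgood _).2
  -- conclusion: the bad family is not bad after all
  have hnat := shwRung_card_filter_le_and_add_not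
    (fun x : Fin (N j) → Bool => ∀ i, ∃ j',
      gb j (litArrayOfBits (M j) k j x i j').1 x =
        (litArrayOfBits (M j) k j x i j').2) good
  have hcnt : (cnt j (gb j) : ℝ) ≤ ε / 2 * 2 ^ (N j) + ε / 2 * 2 ^ (N j) := by
    have h' := (Nat.cast_le (α := ℝ)).2 hnat
    push_cast at h'
    exact h'.trans (add_le_add hgoodset hbadset)
  linarith

/-! ## The AC⁰ rung -/

/-- **Rung assembly (registered stub `stub_rungAssembly` of crux stmt-PneNP-2460, Line A).** From
the named fact `HuangSellke2025KSat`, the truncation-surrogate stub (`hT`) and Tal's tails in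
asymptotic form (`hA`): there is `k₀` such that for all `k ≥ k₀`, `d`, `c`, `ε > 0`, eventually in
`n`, whenever `n = 2^j` and `m = ⌊5 · 2^k log k / k · n⌋`, every family `C : Fin (2^j) → Circuit`
of `acBasis` circuits of `acDepth ≤ d` and size `≤ n^c` on the `m·k·(j+1)` instance bits outputs a
satisfying assignment of the decoded literal array for at most `ε · 2^{m k (j+1)}` inputs. The
class rung `shw_classRung` for the classes `𝒢 n N = {C.eval | C over acBasis, acDepth ≤ d,
size ≤ n^c}`. CONDITIONAL on the named fact (hypothesis `hLDH`). -/
theorem stub_rungAssembly (hLDH : HuangSellke2025KSat)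
    (hT : ∀ {N n' : ℕ} (D : ℕ), 1 ≤ D → ∀ (g : Fin n' → (Fin N → Bool) → Bool) (τ : ℝ),
      (∀ v, tailWeight (fun x => sgn (g v x)) D ≤ τ) →
      ∃ c : Fin n' → Finset (Fin N) → ℝ,
        (∀ v S, D ≤ S.card → c v S = 0) ∧
        (∑ x : Fin N → Bool, ∑ v, (∑ S, c v S * walsh S x) ^ 2 ≤ 9 * n' * 2 ^ N) ∧
        ((univ.filter fun x : Fin N → Bool => ¬ ∀ v, (1 ≤ |∑ S, c v S * walsh S x| ∧
            decide (0 ≤ ∑ S, c v S * walsh S x) = g v x)).card : ℝ) ≤ 9 * n' * τ * 2 ^ N)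
    (hA : ∀ d c : ℕ, ∃ D : ℕ → ℕ, (fun n : ℕ => (D n : ℝ)) =o[atTop] (fun n : ℕ => (n : ℝ)) ∧
      (∀ n, 1 ≤ D n) ∧ ∀ᶠ n : ℕ in atTop, ∀ (N : ℕ) (C : Circuit (Fin N)),
        C.IsOver acBasis → C.acDepth ≤ d → C.size ≤ n ^ c →
          tailWeight (fun x => sgn (C.eval x)) (D n) ≤ 1 / (n : ℝ) ^ 3) :
    ∃ k₀ : ℕ, ∀ k : ℕ, k₀ ≤ k → ∀ d c : ℕ, ∀ ε : ℝ, 0 < ε →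
      ∀ᶠ n : ℕ in atTop, ∀ j m : ℕ, n = 2 ^ j → m = ⌊5 * 2 ^ k * Real.log k / k * n⌋₊ →
        ∀ C : Fin (2 ^ j) → Circuit (Fin (m * k * (j + 1))),
          (∀ v, (C v).IsOver acBasis ∧ (C v).acDepth ≤ d ∧ (C v).size ≤ n ^ c) →
          ((univ.filter fun x : Fin (m * k * (j + 1)) → Bool =>
              ∀ i : Fin m, ∃ j' : Fin k, (C (litArrayOfBits m k j x i j').1).eval x =
                (litArrayOfBits m k j x i j').2).card : ℝ)
            ≤ ε * 2 ^ (m * k * (j + 1)) := by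
  obtain ⟨k₀, hcls⟩ := shw_classRung hLDH hT
  refine ⟨k₀, fun k hk d c ε hε => ?_⟩
  obtain ⟨D, hDo, hD1, hTail⟩ := hA d c
  have h := hcls k hk
    (fun n N g => ∃ C : Circuit (Fin N), C.IsOver acBasis ∧ C.acDepth ≤ d ∧ C.size ≤ n ^ c ∧
      g = C.eval)
    D hDo hD1 (hTail.mono fun n hn N g hg => by
      obtain ⟨C, h1, h2, h3, rfl⟩ := hg
      exact hn N C h1 h2 h3) ε hε
  filter_upwards [h] with n hn j m hnj hm C hC
  exact hn j m hnj hm (fun v => (C v).eval) fun v => ⟨C v, (hC v).1, (hC v).2.1, (hC v).2.2, rfl⟩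

end Summit.PneNP.PneNP.Theorems

end
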